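import Literature.Computability.Cryptography.PeriodFindingAccuracy
import Literature.Computability.Cryptography.PeriodFindingRule
import HarnessLib

/-!
# Period finding by eigenvalue estimation of shifts, VI: the per-unit laws and their two bounds

Family `PQC` / quantum-advantage barrier `PPolyOracles`; sixth file towards the discharge of
`Literature.Barriers.QuantumAdvantage.aaronsonChen2017_lem75_quantum` (Aaronson–Chen 2017,
Lemma 7.5 (2)–(3), App. 13: Boneh–Lipton period finding). The read-out law of the shift
experiment (`sandwich_law`) is a product over the units `u` (candidate block length × trial) of
the **per-unit laws** `unitLaw u (γ_u) = ∑_c unitWeight_u (c) · trialWeight_{c}(γ_u)`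
(`sandwich_law_struct`, in the vocabulary `prob`/`pw` of `PeriodFindingRule.lean`). For the two
kinds of tables met by the distinguisher we bound the per-unit probability of the candidate
`candOf u γ_u = Shor1997.candidate n_S Q_u (cEst_u/Q_u)` read off a trial:

* **detection** (`unitLaw_detect_ge`): for a periodic table `F_u = g ∘ (· mod a)` with `g`
  injective (a `PRF^mod` table), the candidate is the period `a` with probability
  `≥ (1 − 2Lv·64/B) · φ(a)/(3a)` — Shor's count of the good characters
  (`Shor1997.totient_div_le_sum_outcomeProb`) times Kitaev's accuracy (`sum_accurateU_ge`), the
  recovery being exact (`cEst_eq_of_accurate`, `Shor1997.candidate_div_eq`);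
* **false candidates** (`unitLaw_candidate_le`): for an injective table (a permutation, or the
  identity at a wrong block length) every value `v ≠ 0` is the candidate with probability
  `≤ 2Lv·64/B + 2(v+1)/Q_u` (uniform characters, `unitWeight_of_injOn`, and
  `card_filter_candidate_eq_le`).

## References

* S. Aaronson, L. Chen, CCC 2017 (arXiv:1612.05903), Lemma 7.5 (2)–(3), App. 13 [AaronsonChen2017].
* P. W. Shor, SIAM J. Comput. 26 (1997) 1484–1509, §5 [Shor1997].
* A. Yu. Kitaev, arXiv:quant-ph/9511026 (1995), §3–§4 [Kitaev1995].
-/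

noncomputable section

namespace Literature.Computability.Cryptography

namespace PeriodFinding

open _root_.Computability Complexity QuantumComplexity Matrix Finset Kitaev1995

/-! ### The per-unit laws -/

section UnitLaw

variable {U : Type*} {Ω : Type*} [DecidableEq Ω] {Lv B : ℕ}

/-- **The law of the read-out of one unit**: the mixture over its character `c` (weights
`unitWeight`) of the independent tests `trialWeight`. [cite: Kitaev1995, §4 (P(h) = q^{-1} sum_{h'} P(h', h))] -/
def unitLaw (Lu : U → ℕ) (F : U → ℕ → Ω) (u : U) (γu : TIdx Lv B → Bool) : ℝ :=
  ∑ c : Fin (Qof Lu u), unitWeight Lu F u c * trialWeight (Qof Lu u) c γu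

/-- Unit weights summed over `Fin Q` (rather than `range Q`) total one. [folklore] -/
theorem sum_unitWeight_fin (Lu : U → ℕ) (F : U → ℕ → Ω) (u : U) :
    ∑ c : Fin (Qof Lu u), unitWeight Lu F u c = 1 := by
  rw [Fin.sum_univ_eq_sum_range (fun c => unitWeight Lu F u c) (Qof Lu u)]
  exact sum_unitWeight Lu F u

/-- **The per-unit laws are probability vectors.** [folklore] -/
theorem unitLaw_isProbVec (Lu : U → ℕ) (F : U → ℕ → Ω) :
    IsProbVec (X := fun _ : U => TIdx Lv B → Bool) (unitLaw Lu F) where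
  nonneg u γu := sum_nonneg fun c _ =>
    mul_nonneg (unitWeight_nonneg Lu F u c) (trialWeight_nonneg _ _ γu)
  total u := by
    unfold unitLaw
    rw [sum_comm]
    simp_rw [← mul_sum, sum_trialWeight, mul_one]
    exact sum_unitWeight_fin Lu F u

/-- The autocorrelation mass only depends on the table below `Q`. [folklore] -/
theorem corrMass_congr {Q : ℕ} {F F' : ℕ → Ω} (h : ∀ v < Q, F v = F' v) (c : ℤ) :
    corrMass Q F c = corrMass Q F' c := by
  unfold corrMass
  have himg : (range Q).image F = (range Q).image F' :=
    image_congr fun v hv => h v (mem_range.1 hv)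
  rw [himg]
  refine sum_congr rfl fun ω _ => ?_
  rw [filter_congr fun v hv => by rw [h v (mem_range.1 hv)]]

/-- The per-unit law only depends on the unit's table below `Q_u`. [folklore] -/
theorem unitLaw_congr (Lu : U → ℕ) {F F' : U → ℕ → Ω} {u : U} (h : ∀ v < Qof Lu u, F u v = F' u v) :
    unitLaw (Lv := Lv) (B := B) Lu F u = unitLaw Lu F' u := by
  funext γu
  unfold unitLaw unitWeight
  simp_rw [corrMass_congr h]

/-- The probability of a per-unit event, mixture form. [folklore] -/
theorem sum_unitLaw_filter (Lu : U → ℕ) (F : U → ℕ → Ω) (u : U) (P : (TIdx Lv B → Bool) → Prop)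
    [DecidablePred P] :
    ∑ γu ∈ univ.filter P, unitLaw Lu F u γu =
      ∑ c : Fin (Qof Lu u), unitWeight Lu F u c *
        ∑ γu ∈ univ.filter P, trialWeight (Qof Lu u) c γu := by
  unfold unitLaw
  rw [sum_comm]
  simp_rw [mul_sum]

end UnitLaw

/-! ### The structured read-out and the product form of the law -/

section Structured

variable {n k₁ k₂ m : ℕ} {U : Type*} [Fintype U] [DecidableEq U] {Ω : Type*} [DecidableEq Ω]
  {Lv B : ℕ}

/-- The structured read-out: control `(u, τ)` sits on control wire `e⁻¹ (u, τ)`. [folklore] -/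
def structRead (e : Fin k₁ ≃ U × TIdx Lv B) (γf : Fin k₁ → Bool) : U → TIdx Lv B → Bool :=
  fun u τ => γf (e.symm (u, τ))

/-- The flat read-out of a structured one. [folklore] -/
def flatRead (e : Fin k₁ ≃ U × TIdx Lv B) (γ : U → TIdx Lv B → Bool) : Fin k₁ → Bool :=
  fun j => γ (e j).1 (e j).2

/-- Structured and flat read-outs correspond bijectively. [folklore] -/
def readEquiv (e : Fin k₁ ≃ U × TIdx Lv B) : (Fin k₁ → Bool) ≃ (U → TIdx Lv B → Bool) where
  toFun := structRead e
  invFun := flatRead e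
  left_inv γf := funext fun j => by simp [structRead, flatRead]
  right_inv γ := funext fun u => funext fun τ => by simp [structRead, flatRead]

omit [DecidableEq U] [DecidableEq Ω] in
/-- **The read-out weights are the product of the trial weights** when the layout `e` matches
units, levels and types. [cite: Kitaev1995, §3 Lemma 8] -/
theorem readWeight_eq_prod (Lu : U → ℕ) (e : Fin k₁ ≃ U × TIdx Lv B) {un : Fin k₁ → U}
    {lev : Fin k₁ → ℕ} {σ : Fin k₁ → Bool} (hun : ∀ j, un j = (e j).1)
    (hlev : ∀ j, lev j = ((e j).2.1 : ℕ)) (hσ : ∀ j, σ j = (e j).2.2.1)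
    (c : (u : U) → Fin (Qof Lu u)) (γf : Fin k₁ → Bool) :
    readWeight Lu un lev σ c γf = ∏ u, trialWeight (Qof Lu u) (c u : ℕ) (structRead e γf u) := by
  unfold readWeight
  have hR : (∏ u, trialWeight (Qof Lu u) (c u : ℕ) (structRead e γf u)) =
      ∏ p : U × TIdx Lv B, uWeight (Qof Lu p.1) (c p.1 : ℕ) p.2 (γf (e.symm p)) := by
    unfold trialWeight structRead
    rw [← Fintype.prod_prod_type']
  rw [hR, ← e.prod_comp]
  refine prod_congr rfl fun j _ => ?_
  rw [Equiv.symm_apply_apply, uWeight, hσ j, lawAngle, uAngle, hun j, hlev j]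

/-- The character mixture of the products is the product of the per-unit laws. [folklore] -/
theorem sum_prod_unitWeight_mul (Lu : U → ℕ) (F : U → ℕ → Ω) (γ : U → TIdx Lv B → Bool) :
    ∑ c : (u : U) → Fin (Qof Lu u), (∏ u, unitWeight Lu F u (c u)) *
        ∏ u, trialWeight (Qof Lu u) (c u : ℕ) (γ u) =
      pw (X := fun _ : U => TIdx Lv B → Bool) (unitLaw Lu F) γ := by
  unfold pw unitLaw
  rw [Fintype.prod_sum]
  refine sum_congr rfl fun c _ => ?_
  rw [← prod_mul_distrib]

/-- **The read-out law in product form.** Under the hypotheses of `sandwich_law`, with the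
control wires laid out by `e` (unit, level, type, repetition), the Born probability that the
structured control read-out lies in `E` is `prob unitLaw E`: the units are independent, each
following its per-unit law. [cite: Kitaev1995, §3 (Lemma 8) and §4; Shor1997, §5] -/
theorem sandwich_law_struct (Lu : U → ℕ) (F : U → ℕ → Ω) (e : Fin k₁ ≃ U × TIdx Lv B)
    {un : Fin k₁ → U} {lev : Fin k₁ → ℕ} {σ : Fin k₁ → Bool} (hun : ∀ j, un j = (e j).1)
    (hlev : ∀ j, lev j = ((e j).2.1 : ℕ)) (hσ : ∀ j, σ j = (e j).2.2.1)
    {J : Type*} [Fintype J] (zv : QReg k₂ ≃ ((u : U) → Fin (Qof Lu u)) × J)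
    (A : Language Bool) (V : QCircuit cliffordT (n + ((k₁ + k₂) + m))) (x : QReg n)
    (R : QReg k₁ → QReg k₂ → QReg m)
    (hV : ∀ (y : QReg k₁) (Z : QReg k₂), V.toMatrix A *ᵥ basisState (coinInput x (Fin.append y Z)) =
      basisState (tri x (Fin.append y Z) (R y Z)))
    (hR : ∀ (Z : QReg k₂) (y y' : QReg k₁), R y Z = R y' Z ↔
      ∀ u, F u (shiftMod (Qof Lu u) (((zv Z).1 u : ℕ) - (trialExp un lev u y : ℤ))) =
        F u (shiftMod (Qof Lu u) (((zv Z).1 u : ℕ) - (trialExp un lev u y' : ℤ))))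
    (E : Finset (U → TIdx Lv B → Bool)) :
    ∑ z ∈ univ.filter (fun z : QReg (n + ((k₁ + k₂) + m)) =>
        structRead e (fun j => z (yWire n k₁ k₂ m j)) ∈ E),
        ‖(sandwich V σ).runOn A (basisState (padInput x ((k₁ + k₂) + m))) z‖ ^ 2 =
      prob (X := fun _ : U => TIdx Lv B → Bool) (unitLaw Lu F) E := by
  classical
  set Ef : Finset (Fin k₁ → Bool) := univ.filter fun γf => structRead e γf ∈ E with hEf
  have hfilter : (univ.filter fun z : QReg (n + ((k₁ + k₂) + m)) =>
      structRead e (fun j => z (yWire n k₁ k₂ m j)) ∈ E) =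
      univ.filter fun z : QReg (n + ((k₁ + k₂) + m)) => (fun j => z (yWire n k₁ k₂ m j)) ∈ Ef := by
    refine filter_congr fun z _ => ?_
    rw [hEf, mem_filter]
    simp
  rw [hfilter, sandwich_law Lu F un lev σ zv A V x R hV hR Ef]
  simp_rw [readWeight_eq_prod Lu e hun hlev hσ, sum_prod_unitWeight_mul]
  unfold prob
  exact sum_equiv (readEquiv e) (fun γf => by rw [hEf, mem_filter]; simp [readEquiv])
    (fun γf _ => rfl)

end Structured

/-! ### The candidate read off a unit and its two bounds -/

section Bounds

variable {U : Type*} {Ω : Type*} [DecidableEq Ω] {Lv B : ℕ}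

/-- **The candidate period read off the trial of unit `u`**: Shor's recovery
`candidate n_S Q_u (ĉ/Q_u)` on the exactly recovered character `ĉ = cEst`.
[cite: Shor1997, §5 (continued fraction recovery of d/r)] -/
def candOf (Lu : U → ℕ) (nS : U → ℕ) (u : U) (γu : TIdx Lv B → Bool) : ℕ :=
  Shor1997.candidate (nS u) (Qof Lu u) ((cEst (Qof Lu u) γu : ℝ) / Qof Lu u)

/-- The accuracy defect `η = 2 Lv · 64 / B` of a trial. [cite: Kitaev1995, §3 (before Lemma 9)] -/
def ηacc (Lv B : ℕ) : ℝ := (2 * Lv : ℕ) * ((64 : ℝ) / B)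

/-- **False candidates are rare on injective tables**: if `F_u` is injective on `[0, Q_u)` then
every value `v ≠ 0` (with `v < 2 Q_u`) is the candidate with probability
`≤ η + 2 (v + 1) / Q_u`: either the read-out is inaccurate (weight `≤ η` under every character)
or the character, uniform on `[0, Q_u)`, is one of the `≤ 2(v+1)` characters with candidate `v`.
[cite: AaronsonChen2017, App. 13 (proof of Lemma 7.5 (3): "f is a permutation")] -/
theorem unitLaw_candidate_le (Lu : U → ℕ) (F : U → ℕ → Ω) (nS : U → ℕ) (hB : 0 < B) (hLv : 0 < Lv)
    {u : U} (hQLv : Qof Lu u ≤ 2 ^ (Lv - 1)) (hF : Set.InjOn (F u) (range (Qof Lu u) : Set ℕ))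
    {v : ℕ} (hv : v ≠ 0) (hvQ : v < 2 * Qof Lu u) :
    ∑ γu ∈ univ.filter (fun γu : TIdx Lv B → Bool => candOf Lu nS u γu = v), unitLaw Lu F u γu ≤
      ηacc Lv B + 2 * (v + 1) / Qof Lu u := by
  classical
  have hQ := Qof_pos Lu u
  have hQr : (0 : ℝ) < Qof Lu u := by exact_mod_cast hQ
  rw [sum_unitLaw_filter]
  -- per character: inaccurate mass `≤ η`, plus everything if `candidate (c/Q) = v`
  have hper : ∀ c : Fin (Qof Lu u),
      ∑ γu ∈ univ.filter (fun γu : TIdx Lv B → Bool => candOf Lu nS u γu = v),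
        trialWeight (Qof Lu u) c γu ≤
      ηacc Lv B + if Shor1997.candidate (nS u) (Qof Lu u) ((c : ℝ) / Qof Lu u) = v then 1 else 0 := by
    intro c
    have hsplit := sum_filter_add_sum_filter_not (univ.filter fun γu : TIdx Lv B → Bool =>
      candOf Lu nS u γu = v) (fun γu => AccurateU (Qof Lu u) c γu) (trialWeight (Qof Lu u) c)
    rw [← hsplit, filter_filter, filter_filter]
    have h1 : ∑ γu ∈ univ.filter (fun γu : TIdx Lv B → Bool =>
        candOf Lu nS u γu = v ∧ AccurateU (Qof Lu u) c γu), trialWeight (Qof Lu u) c γu ≤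
        if Shor1997.candidate (nS u) (Qof Lu u) ((c : ℝ) / Qof Lu u) = v then 1 else 0 := by
      split_ifs with hc
      · calc _ ≤ ∑ γu, trialWeight (Qof Lu u) c γu :=
              sum_le_sum_of_subset_of_nonneg (filter_subset _ _) fun γu _ _ =>
                trialWeight_nonneg _ _ γu
          _ = 1 := sum_trialWeight _ _
      · rw [sum_eq_zero]
        intro γu hγu
        obtain ⟨hcand, hacc⟩ := (mem_filter.1 hγu).2
        exfalso
        apply hc
        rw [← hcand, candOf, cEst_eq_of_accurate hB hLv hQLv c.isLt hacc]
    have h2 : ∑ γu ∈ univ.filter (fun γu : TIdx Lv B → Bool =>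
        candOf Lu nS u γu = v ∧ ¬ AccurateU (Qof Lu u) c γu), trialWeight (Qof Lu u) c γu ≤
        ηacc Lv B :=
      calc _ ≤ ∑ γu ∈ univ.filter (fun γu : TIdx Lv B → Bool => ¬ AccurateU (Qof Lu u) c γu),
            trialWeight (Qof Lu u) c γu :=
            sum_le_sum_of_subset_of_nonneg (fun γu hγu => mem_filter.2
              ⟨mem_univ _, ((mem_filter.1 hγu).2).2⟩) fun γu _ _ => trialWeight_nonneg _ _ γu
        _ ≤ ηacc Lv B := sum_not_accurateU_le hB _ _
    linarith
  -- average over the uniform character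
  have hw : ∀ c : Fin (Qof Lu u), unitWeight Lu F u c = 1 / (Qof Lu u : ℝ) := fun c =>
    unitWeight_of_injOn Lu F u hF c
  calc ∑ c : Fin (Qof Lu u), unitWeight Lu F u c *
        ∑ γu ∈ univ.filter (fun γu : TIdx Lv B → Bool => candOf Lu nS u γu = v),
          trialWeight (Qof Lu u) c γu
      ≤ ∑ c : Fin (Qof Lu u), (1 / (Qof Lu u : ℝ)) * (ηacc Lv B +
          if Shor1997.candidate (nS u) (Qof Lu u) ((c : ℝ) / Qof Lu u) = v then 1 else 0) :=
        sum_le_sum fun c _ => by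
          rw [hw c]
          exact mul_le_mul_of_nonneg_left (hper c) (by positivity)
    _ = ηacc Lv B + (1 / (Qof Lu u : ℝ)) *
          (((range (Qof Lu u)).filter fun c : ℕ =>
            Shor1997.candidate (nS u) (Qof Lu u) ((c : ℝ) / Qof Lu u) = v).card : ℕ) := by
        rw [← mul_sum, sum_add_distrib, sum_const, card_univ, Fintype.card_fin, nsmul_eq_mul,
          ← sum_boole, Fin.sum_univ_eq_sum_range (fun c : ℕ =>
            if Shor1997.candidate (nS u) (Qof Lu u) ((c : ℝ) / Qof Lu u) = v then (1 : ℝ) else 0)]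
        field_simp
    _ ≤ ηacc Lv B + (1 / (Qof Lu u : ℝ)) * (2 * (v + 1) : ℕ) := by
        have h := card_filter_candidate_eq_le (n := nS u) hQ hv hvQ
        have h' : ((((range (Qof Lu u)).filter fun c : ℕ =>
            Shor1997.candidate (nS u) (Qof Lu u) ((c : ℝ) / Qof Lu u) = v).card : ℕ) : ℝ) ≤
            (2 * (v + 1) : ℕ) := by exact_mod_cast h
        have := mul_le_mul_of_nonneg_left h' (by positivity : (0 : ℝ) ≤ 1 / (Qof Lu u : ℝ))
        linarith
    _ = ηacc Lv B + 2 * (v + 1) / Qof Lu u := by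
        push_cast
        ring

/-- Shor's threshold `n₀` beyond which every good outcome has probability `≥ 1/3r²`
(`Shor1997.totient_div_le_sum_outcomeProb`). [cite: Shor1997, §5 (counting the good states)] -/
def shorThreshold : ℕ := Classical.choose Shor1997.totient_div_le_sum_outcomeProb

/-- The specification of `shorThreshold`. [cite: Shor1997, §5 (counting the good states)] -/
theorem shorThreshold_spec : ∀ n q r : ℕ, shorThreshold ≤ n → n ^ 2 ≤ q → q < 2 * n ^ 2 →
    (∃ l : ℕ, q = 2 ^ l) → 0 < r → r < n →
      (Nat.totient r : ℝ) / (3 * r) ≤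
        ∑ k ∈ range r, ∑ c ∈ (range q).filter
          (fun c : ℕ => ∃ d < r, d.Coprime r ∧ 2 * |(r : ℤ) * c - d * q| ≤ r),
            Shor1997.outcomeProb q r k c :=
  Classical.choose_spec Shor1997.totient_div_le_sum_outcomeProb

/-- **Detection on periodic tables**: if `F_u = g ∘ (· mod a)` with `g` injective on `[0, a)`
(a `PRF^mod` table read at its own block length), `n_S² ≤ Q_u < 2 n_S²`, `0 < a < n_S` and
`n_S ≥ n₀`, then the candidate read off the unit is the period `a` with probability at least
`(1 − η) · φ(a)/(3a)`: with probability `≥ φ(a)/(3a)` the character `c` is good — some `d < a`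
coprime to `a` has `2|ac − dQ| ≤ a` (Shor 1997, §5) — and then, on every accurate read-out
(weight `≥ 1 − η`), `cEst = c` and `candidate n_S Q (c/Q) = a`.
[cite: AaronsonChen2017, App. 13 (proof of Lemma 7.5 (2))] -/
theorem unitLaw_detect_ge (Lu : U → ℕ) (F : U → ℕ → Ω) (nS : U → ℕ) (hB : 0 < B) (hLv : 0 < Lv)
    {u : U} (hQLv : Qof Lu u ≤ 2 ^ (Lv - 1)) (hn₀ : shorThreshold ≤ nS u)
    (hnQ : nS u ^ 2 ≤ Qof Lu u) (hQn : Qof Lu u < 2 * nS u ^ 2) {a : ℕ} (ha : 0 < a)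
    (han : a < nS u) (g : ℕ → Ω) (hg : Set.InjOn g (range a : Set ℕ))
    (hF : ∀ v, F u v = g (v % a)) :
    (1 - ηacc Lv B) * ((Nat.totient a : ℝ) / (3 * a)) ≤
      ∑ γu ∈ univ.filter (fun γu : TIdx Lv B → Bool => candOf Lu nS u γu = a), unitLaw Lu F u γu := by
  classical
  have hQ := Qof_pos Lu u
  have haQ : a ≤ Qof Lu u := by nlinarith
  rw [sum_unitLaw_filter]
  -- on a good character every accurate read-out returns `a`
  have hper : ∀ c : Fin (Qof Lu u),
      (∃ d < a, d.Coprime a ∧ 2 * |(a : ℤ) * (c : ℕ) - d * (Qof Lu u)| ≤ a) →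
      1 - ηacc Lv B ≤ ∑ γu ∈ univ.filter (fun γu : TIdx Lv B → Bool => candOf Lu nS u γu = a),
        trialWeight (Qof Lu u) c γu := by
    intro c hc
    obtain ⟨d, -, hcop, hclose⟩ := hc
    refine (sum_accurateU_ge hB (Qof Lu u) c).trans
      (sum_le_sum_of_subset_of_nonneg (fun γu hγu => ?_) fun γu _ _ => trialWeight_nonneg _ _ γu)
    have hacc := (mem_filter.1 hγu).2
    refine mem_filter.2 ⟨mem_univ _, ?_⟩
    rw [candOf, cEst_eq_of_accurate hB hLv hQLv c.isLt hacc]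
    exact Shor1997.candidate_div_eq hnQ ha han hcop hclose
  -- the good characters have weight `≥ φ(a)/(3a)`
  have hgoodmass : (Nat.totient a : ℝ) / (3 * a) ≤
      ∑ c ∈ univ.filter (fun c : Fin (Qof Lu u) =>
        ∃ d < a, d.Coprime a ∧ 2 * |(a : ℤ) * (c : ℕ) - d * (Qof Lu u)| ≤ a), unitWeight Lu F u c := by
    have h := shorThreshold_spec (nS u) (Qof Lu u) a hn₀ hnQ hQn ⟨Lu u, rfl⟩ ha han
    rw [sum_comm] at h
    refine h.trans (le_of_eq ?_)
    rw [sum_filter, sum_filter, ← Fin.sum_univ_eq_sum_range (fun c : ℕ =>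
      if (∃ d < a, d.Coprime a ∧ 2 * |(a : ℤ) * c - d * (Qof Lu u)| ≤ a) then
        ∑ k ∈ range a, Shor1997.outcomeProb (Qof Lu u) a k c else 0) (Qof Lu u)]
    refine sum_congr rfl fun c _ => ?_
    split_ifs with hc
    · exact (unitWeight_periodic Lu F u ha haQ g hg hF c).symm
    · rfl
  have hnonneg : ∀ c : Fin (Qof Lu u), 0 ≤ unitWeight Lu F u c *
      ∑ γu ∈ univ.filter (fun γu : TIdx Lv B → Bool => candOf Lu nS u γu = a),
        trialWeight (Qof Lu u) c γu := fun c =>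
    mul_nonneg (unitWeight_nonneg Lu F u c) (sum_nonneg fun γu _ => trialWeight_nonneg _ _ γu)
  by_cases hη : 0 ≤ 1 - ηacc Lv B
  · calc (1 - ηacc Lv B) * ((Nat.totient a : ℝ) / (3 * a))
        ≤ (1 - ηacc Lv B) * ∑ c ∈ univ.filter (fun c : Fin (Qof Lu u) =>
            ∃ d < a, d.Coprime a ∧ 2 * |(a : ℤ) * (c : ℕ) - d * (Qof Lu u)| ≤ a),
            unitWeight Lu F u c := mul_le_mul_of_nonneg_left hgoodmass hη
      _ = ∑ c ∈ univ.filter (fun c : Fin (Qof Lu u) =>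
            ∃ d < a, d.Coprime a ∧ 2 * |(a : ℤ) * (c : ℕ) - d * (Qof Lu u)| ≤ a),
            unitWeight Lu F u c * (1 - ηacc Lv B) := by rw [mul_comm, sum_mul]
      _ ≤ ∑ c ∈ univ.filter (fun c : Fin (Qof Lu u) =>
            ∃ d < a, d.Coprime a ∧ 2 * |(a : ℤ) * (c : ℕ) - d * (Qof Lu u)| ≤ a),
            unitWeight Lu F u c *
              ∑ γu ∈ univ.filter (fun γu : TIdx Lv B → Bool => candOf Lu nS u γu = a),
                trialWeight (Qof Lu u) c γu :=
          sum_le_sum fun c hc => mul_le_mul_of_nonneg_left (hper c (mem_filter.1 hc).2)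
            (unitWeight_nonneg Lu F u c)
      _ ≤ ∑ c : Fin (Qof Lu u), unitWeight Lu F u c *
            ∑ γu ∈ univ.filter (fun γu : TIdx Lv B → Bool => candOf Lu nS u γu = a),
              trialWeight (Qof Lu u) c γu :=
          sum_le_sum_of_subset_of_nonneg (filter_subset _ _) fun c _ _ => hnonneg c
  · push Not at hη
    exact (mul_nonpos_of_nonpos_of_nonneg hη.le (by positivity)).trans
      (sum_nonneg fun c _ => hnonneg c)

end Bounds


end PeriodFinding

end Literature.Computability.Cryptography

end
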